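import Mathlib
import HarnessLib
import Summits.CriticalPhenomena.PercolationContinuityZ3.Theses.PercTreeValue
import Literature.Probability.Percolation.FiniteEnergy
import Literature.Probability.Percolation.ClusterBoundary

/-!
# `stub_restrictProduct` of line `SketchIdeator2` (crux `TetrahedronDisjointCoexistence`,
# stmt-CriticalPhenomena-7798): restriction squaring

Registered stub `stub_restrictProduct` (S10) of the lead's skeleton
`Cruxes/TetrahedronDisjointCoexistence/Lines/SketchIdeator2.lean`, landed DEF-FREE over tree
declarations.

Statement: on every countable graph `G` and every `p`, for disjoint vertex sets `R₁ ∩ R₂ = ∅`, the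
restricted-connection events `{x₁ ↔ y₁ in R₁}` and `{x₂ ↔ y₂ in R₂}` are independent under
`P_p = bondPercolation G p`:
`P_p({x₁ ↔ y₁ in R₁} ∩ {x₂ ↔ y₂ in R₂}) = P_p(x₁ ↔ y₁ in R₁) · P_p(x₂ ↔ y₂ in R₂)`.

Proof. `{x ↔ y in R}` is determined by the pairs inside `R` (`DCT16.determinedBy_openConnIn`,
support `R.sym2`); disjoint vertex sets have disjoint pair sets (`Set.sym2_inter`); the events are
measurable (`isFinitary_openConnIn` + `isUpperSet_openConnIn`), so the product measure factorises
(`bondPercolation_real_inter_of_disjoint`).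
-/

noncomputable section

namespace Summit.CriticalPhenomena.PercolationContinuityZ3.Theorems.TetrahedronDisjointCoexistence

open MeasureTheory
open Literature.Probability.Percolation Literature.Probability.LatticeModels

variable {V : Type*}

/-- Disjoint vertex sets have disjoint sets of inside pairs: `R₁.sym2 ∩ R₂.sym2 = (R₁ ∩ R₂).sym2 = ∅`. -/
theorem restrictProduct_disjoint_sym2 {R₁ R₂ : Set V} (hdisj : Disjoint R₁ R₂) :
    Disjoint R₁.sym2 R₂.sym2 := by
  rw [Set.disjoint_iff_inter_eq_empty] at hdisj ⊢
  rw [← Set.sym2_inter, hdisj, Set.sym2_empty]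

/-- `{x ↔ y in R}` is measurable for every vertex set `R` of a countable vertex type (finitary and
increasing). -/
theorem restrictProduct_measurableSet_openConnIn [Countable V] (R : Set V) (x y : V) :
    MeasurableSet (openConnIn R x y : Set (BondConfig V)) := by
  classical
  exact (isFinitary_openConnIn R x y).measurableSet (isUpperSet_openConnIn R x y)

/-- **S10 — restriction squaring.** Connections INSIDE two disjoint vertex sets are independent:
for disjoint `R₁, R₂`, `P_p({x₁ ↔ y₁ in R₁} ∩ {x₂ ↔ y₂ in R₂}) = P_p(x₁ ↔ y₁ in R₁) · P_p(x₂ ↔ y₂ in R₂)`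
on every countable graph and every `p` (the events are determined by the disjoint pair sets
`R₁.sym2`, `R₂.sym2`: `DCT16.determinedBy_openConnIn`, `bondPercolation_real_inter_of_disjoint`). -/
theorem stub_restrictProduct {V : Type*} [Countable V] (G : SimpleGraph V) (p : unitInterval)
    {R₁ R₂ : Set V} (hdisj : Disjoint R₁ R₂) (x₁ y₁ x₂ y₂ : V) :
    (bondPercolation G p).real (openConnIn R₁ x₁ y₁ ∩ openConnIn R₂ x₂ y₂) =
      (bondPercolation G p).real (openConnIn R₁ x₁ y₁) * (bondPercolation G p).real (openConnIn R₂ x₂ y₂) :=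
  bondPercolation_real_inter_of_disjoint G p (restrictProduct_disjoint_sym2 hdisj)
    (DCT16.determinedBy_openConnIn R₁ x₁ y₁ le_rfl) (DCT16.determinedBy_openConnIn R₂ x₂ y₂ le_rfl)
    (restrictProduct_measurableSet_openConnIn R₁ x₁ y₁)
    (restrictProduct_measurableSet_openConnIn R₂ x₂ y₂)

end Summit.CriticalPhenomena.PercolationContinuityZ3.Theorems.TetrahedronDisjointCoexistence

end
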